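import Literature.AlgebraicGeometry.HodgeTheory.CurvePoleSpaces
import Literature.Geometry.Kaehler.CurveOneFormsBound
import Literature.AlgebraicGeometry.HodgeTheory.JacobianHodgeGenus
import Literature.AlgebraicGeometry.HodgeTheory.HodgeTypeConjugation
import Literature.AlgebraicGeometry.HodgeTheory.HodgeModelConnected
import Literature.AlgebraicGeometry.HodgeTheory.HypersurfaceHolomorphicForms
import HarnessLib

/-!
# `h^{1,0}(C) ≤ g(C)` for smooth projective complex curves, and the Jacobian dimension fact

Family `hodge`, layer `Literature/AlgebraicGeometry/HodgeTheory`. Theorem-only file (no definition,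
no named fact — D-0026) closing the Hodge-theoretic half of the residual of the named fact
`Motives.two_mul_dim_eq_finrank_bettiCohomology` (`Motives/Jacobian`; Milne, *Jacobian Varieties*,
Prop. 2.1: `dim J = g`), read through the Hodge genus in `JacobianHodgeGenus`
(`two_mul_dim_eq_finrank_bettiCohomology_iff_forall_finrank_hodgeOneZero_le`:
the fact ⟺ `∀ C 𝒥, h^{1,0}(C) ≤ dim J`):

* `finrank_hodgeOneZero_le_curveGenus` — **`h^{1,0}(C) = dim_ℂ H^{1,0}(C(ℂ)) ≤ g(C)`**, the genus
  of the function field (`CurvePlaces.curveGenus`, Riemann–Roch genus), for every smooth projective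
  complex curve: on a Hodge model `A` of `C` (compact connected complex curve `A.carrier`), the pole
  spaces `L(N·P)^an` of `CurvePoleSpaces.exists_poleSpace` (GAGA §2 n°6 + Riemann's inequality) feed
  `Geometry/Kaehler/CurveOneFormsBound.rank_hodgePQ_one_one_zero_le` (residue pairing, identity
  theorem, duality), bounding the span of the classes of closed `(1,0)`-forms; `H^{1,0}(C) ⊆ H¹(C(ℂ); ℂ)`
  embeds into it along the comparison `A.pullback` (`isOfHodgeType_iff_mem_hodgePQ`). In print this is
  the inequality `dim H⁰(C, Ω¹) ≤ g` (Griffiths–Harris p. 245; Forster Thm. 16.9/17.12), here WITHOUT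
  GAGA for differential forms or Serre duality;
* `two_mul_dim_eq_finrank_bettiCohomology_of_forall_curveGenus_le_dim` — hence the named fact follows
  from the purely ALGEBRAIC statement `g(C) ≤ dim J` for the tree's Jacobians (the remaining half of
  Milne Prop. 2.1, a by-product of Weil's construction `J = C^{(g)}/∼`, Milne §§3–7);
* `Jacobian.dim_le_curveGenus` — unconditionally `dim J ≤ g(C)` (`dim J ≤ h^{1,0}(C) ≤ g(C)`);
* `Schoen1988_cyclicPrym_weilClasses_algebraic_degreeSix_of_forall_curveGenus_le_dim_of_exists_weilClass`
  — the Schoen degree-six fact from `[g(C) ≤ dim J on Schoen's data] ∧ [one non-zero algebraic Weil class]`.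

## References

* [Milne1986JacobianVarieties] J. S. Milne, Jacobian varieties, in: Arithmetic Geometry (1986),
  §2 Prop. 2.1, Thm. 2.5; §§3–7.
* [GriffithsHarris1978] P. Griffiths, J. Harris, Principles of Algebraic Geometry (1978), p. 245.
* [SerreGAGA1956] J.-P. Serre, GAGA, Ann. Inst. Fourier 6 (1956), §2 n°6.
* [VoisinHodgeI2002] C. Voisin, Hodge Theory and Complex Algebraic Geometry I (2002), §7.1.1.
-/

noncomputable section

open scoped Manifold ContDiff Topology
open CategoryTheory AlgebraicGeometry
open Literature.AlgebraicGeometry.Motives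
open Literature.AlgebraicTopology.SingularHomology
open Literature.NumberTheory.Transcendental
open Literature.Geometry.Kaehler

namespace Literature.AlgebraicGeometry.HodgeTheory

section HodgeTheory

variable (C : SchemeOver ℂ) [IsIntegral C.left] [SmoothOfRelativeDimension 1 C.hom] [IsProper C.hom]

/-- **`h^{1,0}(C) ≤ g(C)`** for a smooth projective complex curve: the dimension of the space of
classes of Hodge type `(1,0)` in `H¹(C(ℂ); ℂ)` is at most the genus of the function field `ℂ(C)`.
Proof: Hodge model `A` (compact connected complex curve), pole spaces `L(N·P)^an`
(`exists_poleSpace`), `rank_hodgePQ_one_one_zero_le`, and the injection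
`H^{1,0}(C) ↪ H^{1,0}_A` along `A.pullback`. [cite: Milne1986JacobianVarieties, §2 Prop. 2.1]
[cite: SerreGAGA1956, §2 n°6] -/
theorem finrank_hodgeOneZero_le_curveGenus (hC : IsSmoothProjective 1 C) :
    Module.finrank ℂ (hodgeOneZero hC) ≤ CurvePlaces.curveGenus C := by
  classical
  obtain ⟨A⟩ := nonempty_hodgeModel_holds hC
  haveI : CompactSpace A.carrier := A.compactSpace_carrier hC
  haveI : ConnectedSpace A.carrier := A.connectedSpace_carrier hC
  letI : MeasurableSpace A.model := borel A.model
  haveI : BorelSpace A.model := ⟨rfl⟩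
  have h1 : Module.finrank ℂ A.model = 1 := A.isAnalytification.finrank_eq
  haveI : Fact (Module.finrank ℝ A.model = 2) := ⟨by
    rw [← Module.finrank_mul_finrank ℝ ℂ A.model, Complex.finrank_real_complex, h1]⟩
  obtain ⟨ℓ⟩ : Nonempty (A.model ≃L[ℂ] ℂ) :=
    ⟨ContinuousLinearEquiv.ofFinrankEq (by rw [h1, Module.finrank_self])⟩
  obtain ⟨p⟩ : Nonempty A.carrier := inferInstance
  have hV := fun N : ℕ ↦ exists_poleSpace hC A.isAnalytification ℓ p N
  have hmodel := (rank_hodgePQ_one_one_zero_le h1 ℓ p hV).2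
  haveI : Module.Finite ℂ (singularCohomology ℂ ℂ A.carrier 1) := by
    haveI := finite_complexBetti_of_isSmoothProjective hC 1
    exact Module.Finite.of_surjective (A.pullback 1).hom (A.pullback_surjective 1)
  have hP : Module.finrank ℂ (A.hodgePQ 1 1 0) ≤ CurvePlaces.curveGenus C := by
    rw [HodgeModel.hodgePQ, LinearEquiv.finrank_map_eq]
    exact hmodel
  let f : hodgeOneZero hC →ₗ[ℂ] A.hodgePQ 1 1 0 :=
    LinearMap.codRestrict _ ((A.pullback 1).hom.comp (hodgeOneZero hC).subtype)
      fun x ↦ (isOfHodgeType_iff_mem_hodgePQ hC A _).1 x.2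
  have hf : Function.Injective f := by
    intro a b hab
    apply Subtype.ext
    apply A.pullback_injective 1
    exact congrArg Subtype.val hab
  exact (LinearMap.finrank_le_finrank_of_injective hf).trans hP

/-- **`dim J ≤ g(C)`** for every Jacobian of a smooth projective complex curve
(`dim J ≤ h^{1,0}(C)`, `Jacobian.dim_le_finrank_hodgeOneZero`, and `h^{1,0}(C) ≤ g(C)`).
[cite: Milne1986JacobianVarieties, §2 Prop. 2.1] -/
theorem Jacobian.dim_le_curveGenus (hC : IsSmoothProjective 1 C) (𝒥 : Jacobian C) :
    𝒥.J.dim ≤ CurvePlaces.curveGenus C :=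
  (Jacobian.dim_le_finrank_hodgeOneZero hC 𝒥).trans (finrank_hodgeOneZero_le_curveGenus C hC)

end HodgeTheory

section Reduction

/-- **The Jacobian dimension fact follows from `g(C) ≤ dim J`.** If for every smooth projective
complex curve `C` and every Jacobian `𝒥` of `C` (in the tree's universal-property sense) the genus of
the function field is at most `dim J`, then `2 dim J = b₁(C(ℂ))` for all of them
(`h^{1,0}(C) ≤ g(C) ≤ dim J` and `JacobianHodgeGenus`). The hypothesis is the algebraic half of Milne
Prop. 2.1 (`dim J = g`), a by-product of Weil's construction of the Jacobian.
[cite: Milne1986JacobianVarieties, §2 Prop. 2.1 and §7] -/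
theorem two_mul_dim_eq_finrank_bettiCohomology_of_forall_curveGenus_le_dim
    (h : ∀ (C : SchemeOver ℂ) [IsIntegral C.left] [SmoothOfRelativeDimension 1 C.hom]
      [IsProper C.hom], IsSmoothProjective 1 C → ∀ 𝒥 : Jacobian C,
        CurvePlaces.curveGenus C ≤ 𝒥.J.dim) :
    Motives.two_mul_dim_eq_finrank_bettiCohomology := by
  refine two_mul_dim_eq_finrank_bettiCohomology_of_forall_finrank_hodgeOneZero_le fun C hC 𝒥 ↦ ?_
  haveI := hC.smoothOfRelativeDimension
  haveI : IsIntegral C.left := IsSmoothProjective.isIntegral_holds hC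
  haveI : IsProper C.hom := IsSmoothProjective.isProper_holds hC
  exact (finrank_hodgeOneZero_le_curveGenus C hC).trans (h C hC 𝒥)

/-- **Schoen's degree-six fact from `g(C) ≤ dim J` on Schoen's data and one algebraic Weil class**:
the hypothesis `hg` of
`Schoen1988_cyclicPrym_weilClasses_algebraic_degreeSix_of_finrank_hodgeOneZero_le_of_exists_weilClass`
(`h^{1,0}(C) ≤ dim J`) is implied by `g(C) ≤ dim J`. [cite: Schoen1988HodgeWeil, Thm. 2.0 and Cor. 3.1 (p. 24)]
[cite: Milne1986JacobianVarieties, §2 Prop. 2.1] -/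
theorem finrank_hodgeOneZero_le_dim_of_curveGenus_le_dim {C : SchemeOver ℂ}
    (hC : IsSmoothProjective 1 C) (𝒥 : Jacobian C)
    (h : ∀ [IsIntegral C.left] [SmoothOfRelativeDimension 1 C.hom] [IsProper C.hom],
      CurvePlaces.curveGenus C ≤ 𝒥.J.dim) :
    Module.finrank ℂ (hodgeOneZero hC) ≤ 𝒥.J.dim := by
  haveI := hC.smoothOfRelativeDimension
  haveI : IsIntegral C.left := IsSmoothProjective.isIntegral_holds hC
  haveI : IsProper C.hom := IsSmoothProjective.isProper_holds hC
  exact (finrank_hodgeOneZero_le_curveGenus C hC).trans h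

end Reduction

end Literature.AlgebraicGeometry.HodgeTheory

end
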